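import Literature.MeasureTheory.Group.UnitsHaarDensity
import Literature.RingTheory.Norm.MatrixAlgebra
import HarnessLib

/-!
# The multiplicative Haar measure `dx / N(x)` on the unit group of `K_∞ = ℝ^{r₁} × ℂ^{r₂}`

Topic `NumberTheory/Automorphic`; namespace `Literature.NumberTheory.Automorphic`. Proof file (one
definition with body, theorems): the specialisation to `A = K_∞ = mixedSpace K` and `dx = volume` of
the tree's `Literature.MeasureTheory.Group.unitsHaarOfAddHaar` (the Haar measure `|N_{A/ℝ}(x)|⁻¹ dx`
on the unit group of a finite-dimensional real normed algebra, `UnitsHaarDensity`). We PROVE: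

* `unitsDensity_eq_of_isUnit` — by the tree's `abs_algebraNorm_mixedSpace`
  (`|N_{K_∞/ℝ}(c)| = mixedEmbedding.norm c`, `Literature.RingTheory.Norm.MatrixAlgebra`) the Haar
  density is `unitsDensity c = (mixedEmbedding.norm c)⁻¹` on units;
* `mixedUnitsHaar K := unitsHaarOfAddHaar volume` (definition) with the instances `IsHaarMeasure` and
  `SigmaFinite` (from `isHaarMeasure_unitsHaarOfAddHaar`, second countability and local compactness of
  `K_∞ˣ`), for Mathlib's σ-algebra `Units.instMeasurableSpace` (Borel: local instance
  `Units.borelSpace_of_isOpenEmbedding`), and `lintegral_mixedUnitsHaar`: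
  `∫_{K_∞ˣ} g(u) d^×u = ∫_{x unit} g(x) N(x)⁻¹ dx` — the archimedean factor `∏_v d^×x_v` of the
  idelic Haar measure (Tate's thesis, Cassels–Fröhlich Ch. XV §2.2).

## References

* J. W. S. Cassels, A. Fröhlich (eds.), *Algebraic Number Theory* (1967), Ch. XV (Tate), §2.2
  [CasselsFrohlichANT1967].
-/

noncomputable section

open scoped Classical ENNReal
open NumberField NumberField.mixedEmbedding NumberField.InfinitePlace MeasureTheory Complex
open Literature.MeasureTheory.Group Literature.RingTheory.Norm

namespace Literature.NumberTheory.Automorphic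

variable (K : Type*) [Field K] [NumberField K]

/-! ### The Haar density of `K_∞ˣ` -/

/-- The norm of a unit of `K_∞` is non-zero. [folklore] -/
theorem norm_ne_zero_of_isUnit {c : mixedSpace K} (hc : IsUnit c) : mixedEmbedding.norm c ≠ 0 := by
  rw [← abs_algebraNorm_mixedSpace, abs_ne_zero]
  exact algebraNorm_ne_zero_of_isUnit hc

/-- **The Haar density of `K_∞ˣ` is `N(x)⁻¹`**: `unitsDensity c = (mixedEmbedding.norm c)⁻¹` for a
unit `c`. [folklore] -/
theorem unitsDensity_eq_of_isUnit {c : mixedSpace K} (hc : IsUnit c) :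
    unitsDensity c = (ENNReal.ofReal (mixedEmbedding.norm c))⁻¹ := by
  have hpos : 0 < mixedEmbedding.norm c := lt_of_le_of_ne (mixedEmbedding.norm_nonneg _)
    (norm_ne_zero_of_isUnit K hc).symm
  rw [unitsDensity_apply, abs_inv, abs_algebraNorm_mixedSpace, ENNReal.ofReal_inv_of_pos hpos]

/-! ### The Haar measure on `K_∞ˣ` -/

attribute [local instance] Units.borelSpace_of_isOpenEmbedding hasSummableGeomSeries_of_finiteDimensional

/-- **The Haar measure `∏_v d^×x_v = dx / N(x)` on `K_∞ˣ`** (`unitsHaarOfAddHaar volume`).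
[cite: CasselsFrohlichANT1967, Ch. XV (Tate), §2.2] -/
def mixedUnitsHaar : Measure (mixedSpace K)ˣ :=
  unitsHaarOfAddHaar (volume : Measure (mixedSpace K))

/-- `mixedUnitsHaar` is a Haar measure. [folklore] -/
instance isHaarMeasure_mixedUnitsHaar : (mixedUnitsHaar K).IsHaarMeasure :=
  isHaarMeasure_unitsHaarOfAddHaar _

/-- `K_∞ˣ` is second countable. [folklore] -/
instance secondCountableTopology_mixedSpace_units : SecondCountableTopology (mixedSpace K)ˣ :=
  Units.secondCountableTopology

/-- `K_∞ˣ` is locally compact. [folklore] -/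
instance locallyCompactSpace_mixedSpace_units : LocallyCompactSpace (mixedSpace K)ˣ :=
  haveI : ProperSpace (mixedSpace K) := FiniteDimensional.proper ℝ (mixedSpace K)
  Units.locallyCompactSpace

/-- `mixedUnitsHaar` is σ-finite. [folklore] -/
instance sigmaFinite_mixedUnitsHaar : SigmaFinite (mixedUnitsHaar K) := by
  infer_instance

/-- **`∫_{K_∞ˣ} g(u) d^×u = ∫_{x unit} g(x) N(x)⁻¹ dx`** for measurable `g ≥ 0` on `K_∞`.
[cite: CasselsFrohlichANT1967, Ch. XV (Tate), §2.2] -/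
theorem lintegral_mixedUnitsHaar {g : mixedSpace K → ℝ≥0∞} (hg : Measurable g) :
    ∫⁻ u, g (u : mixedSpace K) ∂mixedUnitsHaar K =
      ∫⁻ x in {x : mixedSpace K | IsUnit x}, g x * (ENNReal.ofReal (mixedEmbedding.norm x))⁻¹ ∂volume := by
  rw [mixedUnitsHaar, lintegral_unitsHaarOfAddHaar _ hg]
  refine setLIntegral_congr_fun Units.isOpen.measurableSet (fun x hx => ?_)
  rw [unitsDensity_eq_of_isUnit K hx]

end Literature.NumberTheory.Automorphic
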